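import Summits.QuantumFields.YangMills.Theorems.AllWindowsColdBoxTiltedCovSecondOrder
import Summits.QuantumFields.YangMills.Theorems.AllWindowsColdBoxGaussPolyHypercontractivity
import Summits.QuantumFields.YangMills.Theorems.AllWindowsColdBoxDirFreeVarLinear
import Summits.QuantumFields.YangMills.Theorems.AllWindowsColdBoxDirPoincareCubic
import HarnessLib

/-!
# Stub S2 `stub_flatTiltInputs : FlatTiltInputs` of LINE-18 «background-field hypercontractive expansion» — LANDED BY NAME
# (crux `AllWindowsColdBox.BulkMidWindowSU2`, stmt-QuantumFields-24006; skeleton v5 sha16 3c750a37, planner ym-idea-2 g14)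

LINE-18's obligation S2 is the BUNDLE of LINE-17's four datum-independent inputs (registered one by one on the sibling crux
⟨stmt-QuantumFields-24003⟩ `BoxMidWindowsSU22`), all of which are tree theorems now:
* A `TiltedCovSecondOrder` — `…AllWindowsColdBoxTiltedCov.stub_tiltedCovSecondOrder` (second-order tilted covariance, p702649);
* B `GaussPolyHypercontractivity` — `…AllWindowsColdBox.GaussHypercontractivity.stub_gaussPolyHypercontractivity` (Gaussian Bonami, p701323);
* C `DirFreeVarLinear` — `…AllWindowsColdBoxDirFreeVar.stub_dirFreeVarLinear` (perimeter law of the free forest-gauge field, p705029);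
* D `DirPoincareCubic` — `…AllWindowsColdBox.DirPoincare.stub_dirPoincareCubic` (ℓ² forest Poincaré, p703492).
This file is pure bookkeeping: the registered Prop `FlatTiltInputs` is restated verbatim (the four component names now denoting the landed
verbatim copies) and discharged by the 4-tuple of the landed stubs.

HONEST LABEL: a registered bookkeeping obligation of one critic-PASSed line on the R2ξ″ RECORD-rung crux 24006; no crux, rung or summit is
proved; the Yang–Mills mass gap is NOT proved by this file.
-/

set_option autoImplicit false

noncomputable section

open Summit.QuantumFields.YangMills.Theorems.AllWindowsColdBoxTiltedCov (TiltedCovSecondOrder stub_tiltedCovSecondOrder)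
open Summit.QuantumFields.YangMills.Theorems.AllWindowsColdBox.GaussHypercontractivity
  (GaussPolyHypercontractivity stub_gaussPolyHypercontractivity)
open Summit.QuantumFields.YangMills.Theorems.AllWindowsColdBoxDirFreeVar (DirFreeVarLinear stub_dirFreeVarLinear)
open Summit.QuantumFields.YangMills.Theorems.AllWindowsColdBox.DirPoincare (DirPoincareCubic stub_dirPoincareCubic)

namespace Summit.QuantumFields.YangMills.Theorems.AllWindowsColdBoxFlatTilt

/-- The registered stub statement `FlatTiltInputs` of LINE-18 (skeleton v5, sha16 3c750a37) on `AllWindowsColdBox.BulkMidWindowSU2`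
(stmt-QuantumFields-24006), verbatim: the bundle `A ∧ B ∧ C ∧ D` of LINE-17's inputs; registered-stub copy, not a citable fact. -/
abbrev FlatTiltInputs : Prop :=
  TiltedCovSecondOrder ∧ GaussPolyHypercontractivity ∧ DirFreeVarLinear ∧ DirPoincareCubic

/-- **STUB S2 of LINE-18 (stmt-QuantumFields-24006), by name and signature**: the four inputs A, B, C, D of LINE-17 hold (tree theorems
p702649, p701323, p705029, p703492). -/
theorem stub_flatTiltInputs : FlatTiltInputs :=
  ⟨stub_tiltedCovSecondOrder, stub_gaussPolyHypercontractivity, stub_dirFreeVarLinear, stub_dirPoincareCubic⟩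

end Summit.QuantumFields.YangMills.Theorems.AllWindowsColdBoxFlatTilt

end
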